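/-
Copyright (c) 2026 the pub-hodgecm-mathlib formalisation cell (harness21).  Prover seat hodgecm-mathlib-K2E5-p10 (g4), Track B «K2-LIT» ∕ h413
(`stmt-HodgeConjecture-24833`), line `K2_E3_EllipticInputs`, unit U12, §L leaf (LBGL-2b) brick (b-ii)/(C): THE `K`-INTEGRAL OF THE BOREL-SLICE FUNCTIONAL —
`∫_K ∫_𝔟 g(k B k⁻¹) dB dk = c ∫_F ∫_𝔟 g(n⁻(s) B n⁻(s)⁻¹) dB ds` (Bruhat cells of `GL₂(𝒪)`, `B(F)`-equivariance of the slice, the fold `w n⁻(t) = n⁻(t⁻¹) b_t`, `d(t⁻¹) = ‖t‖⁻² dt`).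
2026-09-04.
-/
import Summits.HodgeConjecture.HodgeConjecture.Theorems.K2E3GL2BorelSliceLowerCell        -- ★ (this seat): (LC) the lower-cell slice integral, ★ (Q) the squaring push-forward
import Summits.HodgeConjecture.HodgeConjecture.Theorems.K2E3GL2IntegralPointsBruhatCells   -- ★ p857099 (K2E5-p17 (g3)): Haar on `GL₂(𝒪)` over the two Bruhat cells
import HarnessLib

/-!
# K2_E3 road (h413), §L brick (C) — the `K`-integral of the Borel-slice functional of `𝔤𝔩₂(F)`

Cell `pub/hodgecm-mathlib` (D-0151), Track B, seat K2E5-p10 (g4) (free E5 hand on the E3 §L line; §L lead K2E3-p12 (g4), dealer K2E3-plan (g2)).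
`--supports stmt-HodgeConjecture-24833 --as helper`; THEOREMS ONLY (no definition ∕ instance ∕ notation ∕ named fact ∕ `sorry`); never imports
`Cruxes/…/Lines`.  COUNT-NEUTRAL.

For `g ≥ 0` measurable on `𝔤𝔩₂(F)` put `Ψ_g(x) := ∫⁻_{F³} g(x [[r₀,r₁],[0,r₂]] x⁻¹) dx^{⊗3}(r)` (`x ∈ GL₂(F)`; the slice functional of the Borel subalgebra `𝔟`).  This file proves
  `∫⁻_K Ψ_g(k) dκ(k) = c · 2 ∫⁻_{F⁴} 1[disc ∈ (Fˣ)²] (√‖disc‖)⁻¹ g [[y₁,y₂],[y₀,y₃]] dx^{⊗4}(y)`   (`K = GL₂(𝒪)`, `κ` Haar, `c ≠ 0, ∞` from ★ p857099)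
from three inputs: ★ p857099 `lintegral_glInt_eq_bruhatCells_mkOfDetNeZero` (Haar on `K` over the cells `n⁻(𝒪) B(𝒪) ⊔ w n⁻(𝔭) B(𝒪)`, for right-`B(𝒪)`-invariant `Ψ`),
★ (LC) `lintegral_lowerCell_slice_eq` (the `s`-integral over ALL of `F` carries the Weyl Jacobian), and the elementary structure of `Ψ_g` proved here:
* §1 `B(F)`-EQUIVARIANCE `Ψ_g(x b) = (‖b₁₁‖∕‖b₀₀‖) Ψ_g(x)` for upper-triangular `b` (`Ad(b)` is affine on `𝔟` with slope `b₀₀∕b₁₁` in the coordinate `r₁`); in particular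
  `Ψ_g` is right-`B(𝒪)`-invariant;
* §2 the FOLD `[[t,1],[1,0]] = n⁻(t⁻¹)·[[t,1],[0,−t⁻¹]]` (`t ≠ 0`) ⇒ `Ψ_g(w n⁻ t) = ‖t‖⁻² Ψ_g(n⁻ t⁻¹)`, and the INVERSION `∫⁻ ‖t‖⁻² G(t⁻¹) dt = ∫⁻ G` (`d×x` is inversion
  invariant, ★ `isInvInvariant_of_isHaarMeasure_units`) ⇒ `∫⁻_{𝒪} Ψ_g(n⁻ s) + ∫⁻_{𝔭} Ψ_g(w n⁻ t) = ∫⁻_F Ψ_g(n⁻ s) ds`;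
* §3 `n⁻(s) [[r₀,r₁],[0,r₂]] n⁻(s)⁻¹ = [[r₀ − s r₁, r₁],[s(r₀ − r₂) − s² r₁, r₂ + s r₁]]` and the assembly **`lintegral_glInt_borelSlice_eq`**.
[HarishChandra1999AdmissibleDistributions, Thm. 4.4, §7] [Gelbart1975, Remark 9.23 (`∫_{A∖G} = ∫_N ∫_K`)] [Igusa1978, Ch. II §7]
HONEST LABEL: HC_CM is proved only modulo the 7 printed citations (2 remaining named inputs: hLiu418 = stmt-HodgeConjecture-24832, h413 =
stmt-HodgeConjecture-24833) until rung 0 closes; count-neutral helper toward (LBGL-2b); (L-B_GL) :478 of U12 stays OPEN.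

## References
* [HarishChandra1999AdmissibleDistributions] Harish-Chandra (DeBacker–Sally), *Admissible Invariant Distributions on Reductive p-adic Groups* (1999), Thm. 4.4, §7.
* [Gelbart1975] S. Gelbart, *Automorphic forms on adele groups* (1975), Remark 9.23.
* [Igusa1978] J.-I. Igusa, *Lectures on Forms of Higher Degree* (1978), Ch. II §7.
-/

set_option autoImplicit false
set_option linter.dupNamespace false   -- `Summit.HodgeConjecture.HodgeConjecture.…` (D-0017 nested layout; lakefile exemption for Summits)

noncomputable section

open MeasureTheory Measure Filter Topology Set
open scoped MatrixGroups NNReal ENNReal Pointwise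
open ValuativeRel
open Literature.NumberTheory.Automorphic Literature.NumberTheory.Automorphic.LocalFieldHaar
open Literature.NumberTheory.GaloisRepresentations Literature.NumberTheory.GaloisRepresentations.IsNonarchimedeanLocalField
open Summit.HodgeConjecture.HodgeConjecture.Cruxes.H413.K2E3LocalFieldSquaresHensel
open Summit.HodgeConjecture.HodgeConjecture.Cruxes.H413.K2E3LocalFieldSquarePushforward
open Summit.HodgeConjecture.HodgeConjecture.Cruxes.H413.K2E3GL2BorelSliceLowerCell
open Summit.HodgeConjecture.HodgeConjecture.Cruxes.H413.K2E3GL2IntegralPointsBruhatCells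

namespace Summit.HodgeConjecture.HodgeConjecture.Cruxes.H413.K2E3GL2BorelSliceKIntegral

variable {F : Type*} [Field F] [ValuativeRel F] [TopologicalSpace F] [IsNonarchimedeanLocalField F]

/-! ## §1  `Ad(b)` on `𝔟` and the `B(F)`-equivariance of `Ψ_g` -/

omit [ValuativeRel F] [TopologicalSpace F] [IsNonarchimedeanLocalField F] in
/-- For `b = [[α,β],[0,δ]]` invertible: `b · [[r₀,r₁],[0,r₂]] = [[r₀, (α∕δ) r₁ + (β∕δ)(r₂ − r₀)],[0,r₂]] · b` (`Ad(b)` is affine on `𝔟`).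
[cite: HarishChandra1999AdmissibleDistributions, §7] -/
theorem borel_mul_slice (b : GL (Fin 2) F) (hb : (b : Matrix (Fin 2) (Fin 2) F) 1 0 = 0) (r : Fin 3 → F) :
    (b : Matrix (Fin 2) (Fin 2) F) * !![r 0, r 1; 0, r 2] =
      !![r 0, (b : Matrix (Fin 2) (Fin 2) F) 0 0 / (b : Matrix (Fin 2) (Fin 2) F) 1 1 * r 1 +
          (b : Matrix (Fin 2) (Fin 2) F) 0 1 / (b : Matrix (Fin 2) (Fin 2) F) 1 1 * (r 2 - r 0); 0, r 2] * (b : Matrix (Fin 2) (Fin 2) F) := by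
  have hdet : (b : Matrix (Fin 2) (Fin 2) F).det ≠ 0 := (Matrix.isUnits_det_units b).ne_zero
  rw [Matrix.det_fin_two, hb, mul_zero, sub_zero] at hdet
  have hδ : (b : Matrix (Fin 2) (Fin 2) F) 1 1 ≠ 0 := right_ne_zero_of_mul hdet
  ext i j
  fin_cases i <;> fin_cases j
  · simp [Matrix.mul_apply, Fin.sum_univ_two, hb, mul_comm]
  · simp [Matrix.mul_apply, Fin.sum_univ_two]
    field_simp
    ring
  · simp [Matrix.mul_apply, Fin.sum_univ_two, hb]
  · simp [Matrix.mul_apply, Fin.sum_univ_two, hb, mul_comm]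

omit [ValuativeRel F] [TopologicalSpace F] [IsNonarchimedeanLocalField F] in
/-- `Ad(b) [[r₀,r₁],[0,r₂]] = [[r₀, (α∕δ) r₁ + (β∕δ)(r₂ − r₀)],[0,r₂]]` for `b = [[α,β],[0,δ]] ∈ GL₂(F)`. [cite: HarishChandra1999AdmissibleDistributions, §7] -/
theorem borel_conj_slice (b : GL (Fin 2) F) (hb : (b : Matrix (Fin 2) (Fin 2) F) 1 0 = 0) (r : Fin 3 → F) :
    (b : Matrix (Fin 2) (Fin 2) F) * !![r 0, r 1; 0, r 2] * ((b⁻¹ : GL (Fin 2) F) : Matrix (Fin 2) (Fin 2) F) =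
      !![r 0, (b : Matrix (Fin 2) (Fin 2) F) 0 0 / (b : Matrix (Fin 2) (Fin 2) F) 1 1 * r 1 +
          (b : Matrix (Fin 2) (Fin 2) F) 0 1 / (b : Matrix (Fin 2) (Fin 2) F) 1 1 * (r 2 - r 0); 0, r 2] := by
  rw [borel_mul_slice b hb r, Matrix.mul_assoc, ← Units.val_mul, mul_inv_cancel, Units.val_one, Matrix.mul_one]

section Slice
variable [MeasurableSpace F] [BorelSpace F] (dx : Measure F) [dx.IsAddHaarMeasure]
  [MeasurableSpace (Matrix (Fin 2) (Fin 2) F)] [BorelSpace (Matrix (Fin 2) (Fin 2) F)]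

omit [MeasurableSpace (Matrix (Fin 2) (Fin 2) F)] [BorelSpace (Matrix (Fin 2) (Fin 2) F)] in
/-- **Affine substitution in the coordinate `r₁`**: `∫⁻ h(r₀, a r₁ + c (r₂ − r₀), r₂) dr = ‖a‖⁻¹ ∫⁻ h dr` on `F³` (`a ≠ 0`). [folklore] -/
theorem lintegral_pi_affine_one {a : F} (ha : a ≠ 0) (c : F) (h : (Fin 3 → F) → ℝ≥0∞) (hh : Measurable h) :
    ∫⁻ r : Fin 3 → F, h ![r 0, a * r 1 + c * (r 2 - r 0), r 2] ∂(Measure.pi fun _ : Fin 3 => dx) =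
      ((normAbs F a)⁻¹ : ℝ≥0) * ∫⁻ r, h r ∂(Measure.pi fun _ : Fin 3 => dx) := by
  haveI : T2Space F := (isLocalField F).toT2Space
  haveI : LocallyCompactSpace F := (isLocalField F).toLocallyCompactSpace
  haveI : SecondCountableTopology F := secondCountableTopology_localField F
  let e1 : (Fin 3 → F) ≃ᵐ F × (Fin 2 → F) := MeasurableEquiv.piFinSuccAbove (fun _ : Fin 3 => F) 1
  have he1 : MeasurePreserving e1 (Measure.pi fun _ : Fin 3 => dx) (dx.prod (Measure.pi fun _ : Fin 2 => dx)) :=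
    measurePreserving_piFinSuccAbove (fun _ : Fin 3 => dx) 1
  have h10 : (1 : Fin 3).succAbove 0 = 0 := rfl
  have h11 : (1 : Fin 3).succAbove 1 = 2 := rfl
  -- coordinates: `e1.symm (c, y) = (y 0, c, y 1)`
  have hsymm : ∀ p : F × (Fin 2 → F), e1.symm p = ![p.2 0, p.1, p.2 1] := by
    rintro ⟨u, y⟩
    apply e1.injective
    rw [e1.apply_symm_apply]
    refine Prod.ext rfl ?_
    funext j
    fin_cases j
    · show y 0 = (![y 0, u, y 1] : Fin 3 → F) ((1 : Fin 3).succAbove 0)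
      rw [h10]; rfl
    · show y 1 = (![y 0, u, y 1] : Fin 3 → F) ((1 : Fin 3).succAbove 1)
      rw [h11]; rfl
  -- the two integrands on `F × F²`
  have hT : Continuous fun r : Fin 3 → F => (![r 0, a * r 1 + c * (r 2 - r 0), r 2] : Fin 3 → F) := by
    refine continuous_pi fun i => ?_
    fin_cases i <;> simp <;> fun_prop
  have hm2 : Measurable fun p : F × (Fin 2 → F) => h ![p.2 0, p.1, p.2 1] := by
    refine hh.comp (Continuous.measurable ?_)
    refine continuous_pi fun i => ?_
    fin_cases i <;> simp <;> fun_prop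
  have hm1 : Measurable fun p : F × (Fin 2 → F) => h ![p.2 0, a * p.1 + c * (p.2 1 - p.2 0), p.2 1] := by
    refine hh.comp (Continuous.measurable ?_)
    refine continuous_pi fun i => ?_
    fin_cases i <;> simp <;> fun_prop
  have hL : ∫⁻ r : Fin 3 → F, h ![r 0, a * r 1 + c * (r 2 - r 0), r 2] ∂(Measure.pi fun _ : Fin 3 => dx) =
      ∫⁻ p : F × (Fin 2 → F), h ![p.2 0, a * p.1 + c * (p.2 1 - p.2 0), p.2 1] ∂(dx.prod (Measure.pi fun _ : Fin 2 => dx)) := by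
    refine ((he1.symm e1).lintegral_comp (hh.comp hT.measurable)).symm.trans (lintegral_congr fun p => ?_)
    simp only [Function.comp_apply, hsymm, Matrix.cons_val_zero, Matrix.cons_val_one, Matrix.cons_val_two, Matrix.head_cons, Matrix.tail_cons]
  have hR : ∫⁻ r, h r ∂(Measure.pi fun _ : Fin 3 => dx) = ∫⁻ p : F × (Fin 2 → F), h ![p.2 0, p.1, p.2 1] ∂(dx.prod (Measure.pi fun _ : Fin 2 => dx)) := by
    rw [← (he1.symm e1).lintegral_comp hh]
    exact lintegral_congr fun p => by rw [hsymm]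
  rw [hL, hR, lintegral_prod_symm _ hm1.aemeasurable, lintegral_prod_symm _ hm2.aemeasurable, ← lintegral_const_mul _ hm2.lintegral_prod_left']
  refine lintegral_congr fun y => ?_
  -- the 1-D substitution `u ↦ a u + c (y₁ − y₀)` in the fibre over `y = (r₀, r₂)`
  have h1 : ∫⁻ u, h ![y 0, a * u + c * (y 1 - y 0), y 1] ∂dx = ∫⁻ u, h ![y 0, a * u, y 1] ∂dx := by
    have := lintegral_add_right_eq_self (μ := dx) (fun u => h ![y 0, a * u, y 1]) (a⁻¹ * (c * (y 1 - y 0)))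
    rw [← this]
    refine lintegral_congr fun u => ?_
    simp only [mul_add, ← mul_assoc, mul_inv_cancel₀ ha, one_mul]
  rw [h1]
  exact lintegral_comp_mul_left dx (fun u => h ![y 0, u, y 1]) ha

/-- **`B(F)`-EQUIVARIANCE OF THE SLICE FUNCTIONAL**: for `x ∈ GL₂(F)` and `b = [[α,β],[0,δ]] ∈ GL₂(F)`,
`Ψ_g(x b) = (‖δ‖ ∕ ‖α‖) · Ψ_g(x)`, `Ψ_g(x) = ∫⁻ g(x [[r₀,r₁],[0,r₂]] x⁻¹) dx^{⊗3}(r)`. [cite: HarishChandra1999AdmissibleDistributions, §7] [cite: Gelbart1975, Remark 9.23] -/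
theorem sliceFunctional_mul_borel (g : Matrix (Fin 2) (Fin 2) F → ℝ≥0∞) (hg : Measurable g) (x b : GL (Fin 2) F)
    (hb : (b : Matrix (Fin 2) (Fin 2) F) 1 0 = 0) :
    ∫⁻ r : Fin 3 → F, g (((x * b : GL (Fin 2) F) : Matrix (Fin 2) (Fin 2) F) * !![r 0, r 1; 0, r 2] *
        (((x * b)⁻¹ : GL (Fin 2) F) : Matrix (Fin 2) (Fin 2) F)) ∂(Measure.pi fun _ : Fin 3 => dx) =
      ((normAbs F ((b : Matrix (Fin 2) (Fin 2) F) 1 1) / normAbs F ((b : Matrix (Fin 2) (Fin 2) F) 0 0) : ℝ≥0) : ℝ≥0∞) *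
        ∫⁻ r : Fin 3 → F,
          g ((x : Matrix (Fin 2) (Fin 2) F) * !![r 0, r 1; 0, r 2] * ((x⁻¹ : GL (Fin 2) F) : Matrix (Fin 2) (Fin 2) F)) ∂(Measure.pi fun _ : Fin 3 => dx) := by
  haveI : T2Space F := (isLocalField F).toT2Space
  haveI : SecondCountableTopology F := secondCountableTopology_localField F
  have hdet : (b : Matrix (Fin 2) (Fin 2) F).det ≠ 0 := (Matrix.isUnits_det_units b).ne_zero
  rw [Matrix.det_fin_two, hb, mul_zero, sub_zero] at hdet
  have hα : (b : Matrix (Fin 2) (Fin 2) F) 0 0 ≠ 0 := left_ne_zero_of_mul hdet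
  have hδ : (b : Matrix (Fin 2) (Fin 2) F) 1 1 ≠ 0 := right_ne_zero_of_mul hdet
  -- `Ad(xb) B(r) = Ad(x) B(r')`, `r' = (r₀, (α∕δ) r₁ + (β∕δ)(r₂ − r₀), r₂)`
  have hconj : ∀ r : Fin 3 → F, ((x * b : GL (Fin 2) F) : Matrix (Fin 2) (Fin 2) F) * !![r 0, r 1; 0, r 2] * (((x * b)⁻¹ : GL (Fin 2) F) : Matrix (Fin 2) (Fin 2) F) =
      (x : Matrix (Fin 2) (Fin 2) F) *
        !![(![r 0, (b : Matrix (Fin 2) (Fin 2) F) 0 0 / (b : Matrix (Fin 2) (Fin 2) F) 1 1 * r 1 +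
              (b : Matrix (Fin 2) (Fin 2) F) 0 1 / (b : Matrix (Fin 2) (Fin 2) F) 1 1 * (r 2 - r 0), r 2] : Fin 3 → F) 0,
           (![r 0, (b : Matrix (Fin 2) (Fin 2) F) 0 0 / (b : Matrix (Fin 2) (Fin 2) F) 1 1 * r 1 +
              (b : Matrix (Fin 2) (Fin 2) F) 0 1 / (b : Matrix (Fin 2) (Fin 2) F) 1 1 * (r 2 - r 0), r 2] : Fin 3 → F) 1;
           0,
           (![r 0, (b : Matrix (Fin 2) (Fin 2) F) 0 0 / (b : Matrix (Fin 2) (Fin 2) F) 1 1 * r 1 +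
              (b : Matrix (Fin 2) (Fin 2) F) 0 1 / (b : Matrix (Fin 2) (Fin 2) F) 1 1 * (r 2 - r 0), r 2] : Fin 3 → F) 2] *
        ((x⁻¹ : GL (Fin 2) F) : Matrix (Fin 2) (Fin 2) F) := by
    intro r
    simp only [Matrix.cons_val_zero, Matrix.cons_val_one, Matrix.cons_val_two, Matrix.head_cons, Matrix.tail_cons]
    rw [← borel_conj_slice b hb r, mul_inv_rev, Units.val_mul, Units.val_mul]
    simp only [Matrix.mul_assoc]
  have hG : Measurable fun r : Fin 3 → F => g ((x : Matrix (Fin 2) (Fin 2) F) * !![r 0, r 1; 0, r 2] * ((x⁻¹ : GL (Fin 2) F) : Matrix (Fin 2) (Fin 2) F)) := by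
    refine hg.comp ((continuous_const.mul (continuous_matrix fun i j => ?_)).mul continuous_const).measurable
    fin_cases i <;> fin_cases j <;> simp <;> fun_prop
  simp_rw [hconj]
  rw [lintegral_pi_affine_one dx (div_ne_zero hα hδ) ((b : Matrix (Fin 2) (Fin 2) F) 0 1 / (b : Matrix (Fin 2) (Fin 2) F) 1 1) _ hG]
  congr 1
  rw [map_div₀, inv_div]

/-! ## §2  The fold `[[t,1],[1,0]] = n⁻(t⁻¹) · [[t,1],[0,−t⁻¹]]` and the inversion `d(t⁻¹) = ‖t‖⁻² dt` -/

omit [ValuativeRel F] [TopologicalSpace F] [IsNonarchimedeanLocalField F] [MeasurableSpace F] [BorelSpace F]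
  [MeasurableSpace (Matrix (Fin 2) (Fin 2) F)] [BorelSpace (Matrix (Fin 2) (Fin 2) F)] in
/-- `det [[t,1],[0,−t⁻¹]] ≠ 0`. [folklore] -/
theorem det_foldBorel_ne_zero {t : F} (ht : t ≠ 0) : (!![t, 1; 0, -t⁻¹] : Matrix (Fin 2) (Fin 2) F).det ≠ 0 := by
  rw [Matrix.det_fin_two_of, mul_neg, mul_inv_cancel₀ ht]; simp

omit [ValuativeRel F] [TopologicalSpace F] [IsNonarchimedeanLocalField F] [MeasurableSpace F] [BorelSpace F]
  [MeasurableSpace (Matrix (Fin 2) (Fin 2) F)] [BorelSpace (Matrix (Fin 2) (Fin 2) F)] in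
/-- **The fold**: `[[t,1],[1,0]] = n⁻(t⁻¹) · [[t,1],[0,−t⁻¹]]` in `GL₂(F)` for `t ≠ 0` (the point `w n⁻(t)` of the second Bruhat cell lies over `s = t⁻¹` of the big cell).
[cite: Gelbart1975, Remark 9.23] -/
theorem swapT_eq_lowerUni_mul_foldBorel {t : F} (ht : t ≠ 0) :
    Matrix.GeneralLinearGroup.mkOfDetNeZero (!![t, 1; 1, 0] : Matrix (Fin 2) (Fin 2) F) (det_swapT_ne_zero t) =
      Matrix.GeneralLinearGroup.mkOfDetNeZero (!![1, 0; t⁻¹, 1] : Matrix (Fin 2) (Fin 2) F) (det_lowerUni_ne_zero t⁻¹) *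
        Matrix.GeneralLinearGroup.mkOfDetNeZero (!![t, 1; 0, -t⁻¹] : Matrix (Fin 2) (Fin 2) F) (det_foldBorel_ne_zero ht) := by
  refine Units.ext ?_
  change (!![t, 1; 1, 0] : Matrix (Fin 2) (Fin 2) F) = !![1, 0; t⁻¹, 1] * !![t, 1; 0, -t⁻¹]
  ext i j
  fin_cases i <;> fin_cases j <;> simp [Matrix.mul_apply, Fin.sum_univ_two, ht]

/-- **The slice functional on the second cell**: `Ψ_g([[t,1],[1,0]]) = ‖t‖⁻² · Ψ_g(n⁻(t⁻¹))` for `t ≠ 0`. [cite: Gelbart1975, Remark 9.23] -/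
theorem sliceFunctional_swapT (g : Matrix (Fin 2) (Fin 2) F → ℝ≥0∞) (hg : Measurable g) {t : F} (ht : t ≠ 0) :
    ∫⁻ r : Fin 3 → F, g (((Matrix.GeneralLinearGroup.mkOfDetNeZero (!![t, 1; 1, 0] : Matrix (Fin 2) (Fin 2) F) (det_swapT_ne_zero t) : GL (Fin 2) F) :
        Matrix (Fin 2) (Fin 2) F) * !![r 0, r 1; 0, r 2] *
        (((Matrix.GeneralLinearGroup.mkOfDetNeZero (!![t, 1; 1, 0] : Matrix (Fin 2) (Fin 2) F) (det_swapT_ne_zero t))⁻¹ : GL (Fin 2) F) :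
          Matrix (Fin 2) (Fin 2) F)) ∂(Measure.pi fun _ : Fin 3 => dx) =
      ((((normAbs F t)⁻¹) ^ 2 : ℝ≥0) : ℝ≥0∞) *
        ∫⁻ r : Fin 3 → F, g (((Matrix.GeneralLinearGroup.mkOfDetNeZero (!![1, 0; t⁻¹, 1] : Matrix (Fin 2) (Fin 2) F) (det_lowerUni_ne_zero t⁻¹) :
            GL (Fin 2) F) : Matrix (Fin 2) (Fin 2) F) * !![r 0, r 1; 0, r 2] *
          (((Matrix.GeneralLinearGroup.mkOfDetNeZero (!![1, 0; t⁻¹, 1] : Matrix (Fin 2) (Fin 2) F) (det_lowerUni_ne_zero t⁻¹))⁻¹ : GL (Fin 2) F) :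
            Matrix (Fin 2) (Fin 2) F)) ∂(Measure.pi fun _ : Fin 3 => dx) := by
  rw [swapT_eq_lowerUni_mul_foldBorel ht, sliceFunctional_mul_borel dx g hg _ _ rfl]
  congr 1
  change (((normAbs F (-t⁻¹) / normAbs F t : ℝ≥0)) : ℝ≥0∞) = _
  rw [normAbs_neg, map_inv₀, div_eq_mul_inv, sq]

omit [MeasurableSpace (Matrix (Fin 2) (Fin 2) F)] [BorelSpace (Matrix (Fin 2) (Fin 2) F)] in
/-- **Inversion**: `∫⁻ ‖t‖⁻² H(t⁻¹) dt = ∫⁻ H` on `F` (`d×x = dx∕‖x‖` is inversion invariant, ★ `isInvInvariant_of_isHaarMeasure_units`). [cite: Tate1950, §2.3] -/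
theorem lintegral_normAbs_inv_sq_mul_comp_inv (H : F → ℝ≥0∞) (hH : Measurable H) :
    ∫⁻ t, ((((normAbs F t)⁻¹) ^ 2 : ℝ≥0) : ℝ≥0∞) * H t⁻¹ ∂dx = ∫⁻ s, H s ∂dx := by
  haveI : T2Space F := (isLocalField F).toT2Space
  haveI : BorelSpace Fˣ := Units.borelSpace
  set ν : Measure Fˣ := Measure.comap ((↑) : Fˣ → F) (dx.withDensity fun x => (((normAbs F x)⁻¹ : ℝ≥0) : ℝ≥0∞)) with hν
  haveI : ν.IsHaarMeasure := isHaarMeasure_unitsMeasure dx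
  haveI : ν.IsInvInvariant := isInvInvariant_of_isHaarMeasure_units ν
  have hΦ : Measurable fun t : F => ((((normAbs F t)⁻¹) ^ 2 : ℝ≥0) : ℝ≥0∞) * H t⁻¹ :=
    ((measurable_normAbs.inv.pow_const 2).coe_nnreal_ennreal).mul (hH.comp measurable_inv)
  rw [lintegral_eq_lintegral_unitsMeasure_mul dx _ hΦ, lintegral_eq_lintegral_unitsMeasure_mul dx H hH, ← lintegral_inv_eq_self (μ := ν)]
  refine lintegral_congr fun u => ?_
  have hu : normAbs F (u : F) ≠ 0 := (map_ne_zero (normAbs F)).2 u.ne_zero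
  simp only [Units.val_inv_eq_inv_val, map_inv₀, inv_inv]
  rw [mul_assoc, mul_comm (H _) _, ← mul_assoc, ← ENNReal.coe_mul, sq, mul_assoc, mul_inv_cancel₀ hu, mul_one, mul_comm]

omit [MeasurableSpace (Matrix (Fin 2) (Fin 2) F)] [BorelSpace (Matrix (Fin 2) (Fin 2) F)] in
/-- **The two cells re-assembled over `F`**: for measurable `G ≥ 0`,
`∫⁻ s in 𝒪, G s + ∫⁻ t in 𝔭, ‖t‖⁻² G(t⁻¹) = ∫⁻_F G` (`𝒪 = {‖s‖ ≤ 1}`, `𝔭 = {‖t‖ < 1}`; `t ↦ t⁻¹` maps `𝔭 ∖ 0` onto `{‖s‖ > 1}`). [cite: Gelbart1975, Remark 9.23] -/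
theorem lintegral_cells_eq (G : F → ℝ≥0∞) (hG : Measurable G) :
    ∫⁻ s in primePowBall F 0, G s ∂dx + ∫⁻ t in primePowBall F 1, ((((normAbs F t)⁻¹) ^ 2 : ℝ≥0) : ℝ≥0∞) * G t⁻¹ ∂dx = ∫⁻ s, G s ∂dx := by
  haveI : T2Space F := (isLocalField F).toT2Space
  have hO : MeasurableSet (primePowBall F (0 : ℤ)) := measurableSet_primePowBall 0
  have hP : MeasurableSet (primePowBall F (1 : ℤ)) := measurableSet_primePowBall 1
  -- the second cell as an integral over `{s | s⁻¹ ∈ 𝔭}`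
  have h2 : ∫⁻ t in primePowBall F 1, ((((normAbs F t)⁻¹) ^ 2 : ℝ≥0) : ℝ≥0∞) * G t⁻¹ ∂dx =
      ∫⁻ s, ((fun s => s⁻¹) ⁻¹' primePowBall F 1).indicator G s ∂dx := by
    rw [← lintegral_indicator hP, ← lintegral_normAbs_inv_sq_mul_comp_inv dx _ ((hG.indicator (measurable_inv hP)))]
    refine lintegral_congr fun t => ?_
    by_cases ht : t ∈ primePowBall F 1
    · rw [indicator_of_mem ht, indicator_of_mem (show t⁻¹ ∈ (fun s : F => s⁻¹) ⁻¹' primePowBall F 1 by simpa [inv_inv] using ht)]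
    · rw [indicator_of_notMem ht, indicator_of_notMem (show t⁻¹ ∉ (fun s : F => s⁻¹) ⁻¹' primePowBall F 1 by simpa [inv_inv] using ht),
        mul_zero]
  -- `{s | s⁻¹ ∈ 𝔭}` and `𝒪ᶜ` differ by the null set `{0}`
  have hae : ((fun s : F => s⁻¹) ⁻¹' primePowBall F 1 : Set F) =ᵐ[dx] (primePowBall F 0)ᶜ := by
    have hsub1 : ((fun s : F => s⁻¹) ⁻¹' primePowBall F 1) \ (primePowBall F 0)ᶜ ⊆ {0} := by
      intro s hs
      rw [mem_singleton_iff]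
      by_contra hs0
      have h1 : normAbs F s⁻¹ < 1 := normAbs_lt_one_iff.2 (LocalFieldHaar.mem_primePowBall_one_iff.1 hs.1)
      have h0 : normAbs F s ≤ 1 := normAbs_le_one_iff.2 (LocalFieldHaar.mem_primePowBall_zero_iff.1 (by_contra fun h => hs.2 h))
      rw [map_inv₀] at h1
      have hpos : 0 < normAbs F s := pos_iff_ne_zero.2 ((map_ne_zero (normAbs F)).2 hs0)
      have : 1 < normAbs F s := by rwa [inv_lt_one₀ hpos] at h1
      exact absurd h0 (not_le.2 this)
    have hsub2 : (primePowBall F 0)ᶜ \ ((fun s : F => s⁻¹) ⁻¹' primePowBall F 1) ⊆ (∅ : Set F) := by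
      intro s hs
      exfalso
      apply hs.2
      show s⁻¹ ∈ primePowBall F 1
      rw [LocalFieldHaar.mem_primePowBall_one_iff]
      have h0 : ¬ normAbs F s ≤ 1 := fun h => hs.1 (LocalFieldHaar.mem_primePowBall_zero_iff.2 (normAbs_le_one_iff.1 h))
      have hs0 : s ≠ 0 := by rintro rfl; exact h0 (by simp)
      have hpos : 0 < normAbs F s := pos_iff_ne_zero.2 ((map_ne_zero (normAbs F)).2 hs0)
      exact normAbs_lt_one_iff.1 (by rw [map_inv₀, inv_lt_one₀ hpos]; exact not_le.1 h0)
    exact (ae_eq_set).2 ⟨measure_mono_null hsub1 (measure_singleton_zero dx), measure_mono_null hsub2 measure_empty⟩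
  rw [h2, lintegral_indicator (measurable_inv hP), setLIntegral_congr hae]
  exact lintegral_add_compl G hO

/-! ## §3  `Ad(n⁻(s))` on `𝔟` and the assembly over the Bruhat cells -/

omit [ValuativeRel F] [TopologicalSpace F] [IsNonarchimedeanLocalField F] [MeasurableSpace F] [BorelSpace F]
  [MeasurableSpace (Matrix (Fin 2) (Fin 2) F)] [BorelSpace (Matrix (Fin 2) (Fin 2) F)] in
/-- `n⁻(s) [[r₀,r₁],[0,r₂]] n⁻(s)⁻¹ = [[r₀ − s r₁, r₁],[s(r₀ − r₂) − s² r₁, r₂ + s r₁]]`, `n⁻(s) = [[1,0],[s,1]]`. [cite: HarishChandra1999AdmissibleDistributions, §7] -/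
theorem lowerUni_conj_slice (s : F) (r : Fin 3 → F) :
    ((Matrix.GeneralLinearGroup.mkOfDetNeZero (!![1, 0; s, 1] : Matrix (Fin 2) (Fin 2) F) (det_lowerUni_ne_zero s) : GL (Fin 2) F) : Matrix (Fin 2) (Fin 2) F) *
        !![r 0, r 1; 0, r 2] *
        (((Matrix.GeneralLinearGroup.mkOfDetNeZero (!![1, 0; s, 1] : Matrix (Fin 2) (Fin 2) F) (det_lowerUni_ne_zero s))⁻¹ : GL (Fin 2) F) :
          Matrix (Fin 2) (Fin 2) F) =
      !![r 0 - s * r 1, r 1; s * (r 0 - r 2) - s ^ 2 * r 1, r 2 + s * r 1] := by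
  set n : GL (Fin 2) F := Matrix.GeneralLinearGroup.mkOfDetNeZero (!![1, 0; s, 1] : Matrix (Fin 2) (Fin 2) F) (det_lowerUni_ne_zero s) with hn
  have hcoe : (n : Matrix (Fin 2) (Fin 2) F) = !![1, 0; s, 1] := rfl
  have hmul : (n : Matrix (Fin 2) (Fin 2) F) * !![r 0, r 1; 0, r 2] =
      (!![r 0 - s * r 1, r 1; s * (r 0 - r 2) - s ^ 2 * r 1, r 2 + s * r 1] : Matrix (Fin 2) (Fin 2) F) * (n : Matrix (Fin 2) (Fin 2) F) := by
    rw [hcoe]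
    ext i j
    fin_cases i <;> fin_cases j <;> simp [Matrix.mul_apply, Fin.sum_univ_two] <;> ring
  rw [hmul, Matrix.mul_assoc, ← Units.val_mul, mul_inv_cancel, Units.val_one, Matrix.mul_one]

/-- **THE `K`-INTEGRAL OF THE BOREL-SLICE FUNCTIONAL.**  For `κ` a Haar measure on `K = GL₂(𝒪)` and `dx` an additive Haar measure on `F` (characteristic `≠ 2`) there is
ONE constant `c ∈ (0, ∞)` (twice the cell constant `κ{‖k₀₀‖ = 1}∕dx(𝒪)` of ★ p857099) with, for every measurable `g ≥ 0` on `𝔤𝔩₂(F)`,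
`∫⁻_K ∫⁻_{F³} g(k [[r₀,r₁],[0,r₂]] k⁻¹) dx^{⊗3} dκ = c · ∫⁻_{F⁴} 1[disc ∈ (Fˣ)²] (√‖disc‖)⁻¹ g [[y₁,y₂],[y₀,y₃]] dx^{⊗4}`
(`disc = disc χ` of the matrix): the Lie–Weyl formula for the Borel slice of `𝔤𝔩₂` in chart coordinates — Bruhat cells (★ p857099), `B(𝒪)`-invariance and the fold
(§1–§2), the inversion `t ↦ t⁻¹`, and the lower-cell Jacobian ★ `lintegral_lowerCell_slice_eq`.
[cite: HarishChandra1999AdmissibleDistributions, Thm. 4.4, §7] [cite: Gelbart1975, Remark 9.23] [cite: Igusa1978, Ch. II §7] -/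
theorem lintegral_glInt_sliceFunctional_eq [MeasurableSpace (GL (Fin 2) F)] [BorelSpace (GL (Fin 2) F)] (h2 : (2 : F) ≠ 0)
    (κ : Measure ↥(glInt 2 F)) [κ.IsHaarMeasure] :
    ∃ c : ℝ≥0∞, c ≠ 0 ∧ c ≠ ⊤ ∧ ∀ g : Matrix (Fin 2) (Fin 2) F → ℝ≥0∞, Measurable g →
      ∫⁻ k, ∫⁻ r : Fin 3 → F, g (((k : GL (Fin 2) F) : Matrix (Fin 2) (Fin 2) F) * !![r 0, r 1; 0, r 2] *
          ((((k : GL (Fin 2) F))⁻¹ : GL (Fin 2) F) : Matrix (Fin 2) (Fin 2) F)) ∂(Measure.pi fun _ : Fin 3 => dx) ∂κ =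
        c * ∫⁻ y : Fin 4 → F, {D : F | IsSquare D ∧ D ≠ 0}.indicator (fun D => (((NNReal.sqrt (normAbs F D))⁻¹ : ℝ≥0) : ℝ≥0∞))
          ((!![y 1, y 2; y 0, y 3] : Matrix (Fin 2) (Fin 2) F)).charpoly.discr * g !![y 1, y 2; y 0, y 3] ∂(Measure.pi fun _ : Fin 4 => dx) := by
  haveI : T2Space F := (isLocalField F).toT2Space
  haveI : LocallyCompactSpace F := (isLocalField F).toLocallyCompactSpace
  haveI : SecondCountableTopology F := secondCountableTopology_localField F
  haveI : IsTopologicalRing F := inferInstance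
  obtain ⟨c, hc0, hct, hA⟩ := lintegral_glInt_eq_bruhatCells_mkOfDetNeZero κ dx
  refine ⟨c * 2, mul_ne_zero hc0 two_ne_zero, ENNReal.mul_ne_top hct ENNReal.ofNat_ne_top, fun g hg => ?_⟩
  -- the slice functional `Ψ`
  set Ψ : GL (Fin 2) F → ℝ≥0∞ := fun x => ∫⁻ r : Fin 3 → F,
    g ((x : Matrix (Fin 2) (Fin 2) F) * !![r 0, r 1; 0, r 2] * ((x⁻¹ : GL (Fin 2) F) : Matrix (Fin 2) (Fin 2) F)) ∂(Measure.pi fun _ : Fin 3 => dx) with hΨdef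
  have hjoint : Measurable fun p : GL (Fin 2) F × (Fin 3 → F) =>
      g ((p.1 : Matrix (Fin 2) (Fin 2) F) * !![p.2 0, p.2 1; 0, p.2 2] * ((p.1⁻¹ : GL (Fin 2) F) : Matrix (Fin 2) (Fin 2) F)) := by
    refine hg.comp (Continuous.measurable ?_)
    refine ((Units.continuous_val.comp continuous_fst).mul ?_).mul (Units.continuous_coe_inv.comp continuous_fst)
    refine continuous_matrix fun i j => ?_
    fin_cases i <;> fin_cases j <;> simp <;> fun_prop
  have hΨm : Measurable Ψ := hjoint.lintegral_prod_right'
  -- right `B(𝒪)`-invariance (§1 with `‖b₀₀‖ = ‖b₁₁‖ = 1`)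
  have hΨinv : ∀ k ∈ glInt 2 F, ∀ b ∈ glInt 2 F, ((b : GL (Fin 2) F) : Matrix (Fin 2) (Fin 2) F) 1 0 = 0 → Ψ (k * b) = Ψ k := by
    intro k _ b hb hb10
    have h := sliceFunctional_mul_borel dx g hg k b hb10
    simp only [hΨdef]
    rw [h]
    have hdet := valuation_det_eq_one_of_mem_glInt hb
    rw [Matrix.det_fin_two, hb10, mul_zero, sub_zero, map_mul] at hdet
    have hle := K2E3GL2IntegralPointsCellLemmas.valuation_apply_le_one hb
    have h00 : valuation F (((b : GL (Fin 2) F) : Matrix (Fin 2) (Fin 2) F) 0 0) = 1 :=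
      K2E3GL2IntegralPointsCellLemmas.valuation_eq_one_of_mul_eq_one (hle 0 0) (hle 1 1) hdet
    have h11 : valuation F (((b : GL (Fin 2) F) : Matrix (Fin 2) (Fin 2) F) 1 1) = 1 :=
      K2E3GL2IntegralPointsCellLemmas.valuation_eq_one_of_mul_eq_one (hle 1 1) (hle 0 0) (by rw [mul_comm]; exact hdet)
    rw [normAbs_eq_one_iff_valuation_eq_one.2 h00, normAbs_eq_one_iff_valuation_eq_one.2 h11, div_one, ENNReal.coe_one, one_mul]
  -- Bruhat cells
  have hcell := hA Ψ hΨm hΨinv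
  -- the second cell folded onto `{‖s‖ > 1}`
  have hP : MeasurableSet (primePowBall F (1 : ℤ)) := measurableSet_primePowBall 1
  have hfold : ∫⁻ t in primePowBall F 1, Ψ (Matrix.GeneralLinearGroup.mkOfDetNeZero (!![t, 1; 1, 0] : Matrix (Fin 2) (Fin 2) F) (det_swapT_ne_zero t)) ∂dx =
      ∫⁻ t in primePowBall F 1, ((((normAbs F t)⁻¹) ^ 2 : ℝ≥0) : ℝ≥0∞) *
        Ψ (Matrix.GeneralLinearGroup.mkOfDetNeZero (!![1, 0; t⁻¹, 1] : Matrix (Fin 2) (Fin 2) F) (det_lowerUni_ne_zero t⁻¹)) ∂dx := by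
    have hne : ∀ᵐ t ∂(dx.restrict (primePowBall F 1)), t ∈ ({0}ᶜ : Set F) :=
      ae_restrict_of_ae (compl_mem_ae_iff.2 (measure_singleton_zero dx))
    refine lintegral_congr_ae (hne.mono fun t ht => ?_)
    simp only [hΨdef]
    exact sliceFunctional_swapT dx g hg ht
  -- the lower cell over all of `F`
  have hG : Measurable fun s : F => Ψ (Matrix.GeneralLinearGroup.mkOfDetNeZero (!![1, 0; s, 1] : Matrix (Fin 2) (Fin 2) F) (det_lowerUni_ne_zero s)) :=
    hΨm.comp continuous_lowerUniGL.measurable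
  have hcells := lintegral_cells_eq dx _ hG
  have hlow : ∫⁻ s, Ψ (Matrix.GeneralLinearGroup.mkOfDetNeZero (!![1, 0; s, 1] : Matrix (Fin 2) (Fin 2) F) (det_lowerUni_ne_zero s)) ∂dx =
      2 * ∫⁻ y : Fin 4 → F, {D : F | IsSquare D ∧ D ≠ 0}.indicator (fun D => (((NNReal.sqrt (normAbs F D))⁻¹ : ℝ≥0) : ℝ≥0∞))
        ((!![y 1, y 2; y 0, y 3] : Matrix (Fin 2) (Fin 2) F)).charpoly.discr * g !![y 1, y 2; y 0, y 3] ∂(Measure.pi fun _ : Fin 4 => dx) := by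
    rw [← lintegral_lowerCell_slice_eq dx h2 g hg]
    refine lintegral_congr fun s => ?_
    simp only [hΨdef, lowerUni_conj_slice]
  -- assembly
  show ∫⁻ k, Ψ (k : GL (Fin 2) F) ∂κ = _
  rw [hcell, hfold, hcells, hlow, mul_assoc]

end Slice

end Summit.HodgeConjecture.HodgeConjecture.Cruxes.H413.K2E3GL2BorelSliceKIntegral

end
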